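import Summits.Ventures.YMGap.RobustBall.BoundaryRelativeEntropy
import Summits.Ventures.YMGap.RobustBall.BoundaryFreeEnergyVanHove
import Summits.Ventures.YMGap.RobustBall.BoundaryFreeEnergyDim
import HarnessLib

/-!
# Venture YMGap, track ROBUST-BALL — «C-VAR»: THE GIBBS VARIATIONAL PRINCIPLE IN A FINITE REGION WITH AN ARBITRARY BOUNDARY FIELD —
# no inner state beats the infinite-volume free energy per plaquette by more than a boundary-uniform surface term

HONEST FRAMING. WHAT THIS IS: a venture file (cell `pub-ymgap`, track Y2 ROBUST-BALL / DS, seat ds-3, theorems only, 0 compute). Setting: a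
compact metrisable gauge group `G`, a continuous representation `ρ`, any `d`, any real coupling `b`, a FINITE link volume `Λ`, a boundary field `η`;
`Haar_Λ` the product Haar law on the links of `Λ`, `π_Λ^{b,η} = Haar_Λ.tilted(−b S_Λ(· ⊕ η))` the inner Gibbs law (the tree's `ymSpecification`
kernel before gluing), `Z_Λ(b|η)` its normaliser, `KL` Mathlib's Kullback–Leibler divergence.
* `toReal_klDiv_inner_law_eq` — GENERIC IDENTITY: for every probability law `ν ≪ Haar_Λ` with integrable log-likelihood ratio,
  `KL(ν ‖ π_Λ^{b,η}) = KL(ν ‖ Haar_Λ) + b·ν(S_Λ(· ⊕ η)) + log Z_Λ(b|η)`;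
* ★★ `neg_klDiv_sub_energy_le_log_normaliser` — THE FINITE-VOLUME GIBBS VARIATIONAL INEQUALITY WITH BOUNDARY FIELD `η`:
  `−KL(ν ‖ Haar_Λ) − b·ν(S_Λ(· ⊕ η)) ≤ log Z_Λ(b|η)` for every such `ν`, the deficit being EXACTLY `KL(ν ‖ π_Λ^{b,η})`; `log_normaliser_eq_neg_klDiv_sub_energy`
  — equality for the inner Gibbs law itself; `eq_inner_law_of_deficit_eq_zero` — it is the UNIQUE maximiser;
* ★★★ `su2_neg_klDiv_sub_energy_le` / `su2_variational_lower` — `SU(2)`, `d = 4`, EVERY `0 ≤ β_W ≤ 9/25` (tree `0 ≤ b ≤ 9/50`), composed with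
  «C-DS-I» (`su2_abs_log_normaliser_sub_freeEnergy_le`): for every finite `Λ`, EVERY boundary field `η`, all depth data `(φ, m)` and EVERY inner
  probability law `ν`: `−KL(ν ‖ Haar_Λ) − b·ν(S_Λ(· ⊕ η)) ≤ (#T(Λ)/6)·f(b) + b·Σ_{p∈T(Λ)} min 4 (1024√2·e^{−κ₁(R_G(2b))⌊m_p/4⌋})`, and the inner Gibbs
  law attains `≥ (#T(Λ)/6)·f(b) − b·(same surface sum)`: the supremum over inner states of (entropy − b·energy) IS the volume times the
  infinite-volume free energy per plaquette up to a SURFACE term bounded uniformly in the boundary field — the Lanford–Ruelle / Gibbs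
  variational principle in boundary-uniform finite-volume form, far beyond the cluster-expansion radius;
  ★★ `su2_variational_div_le_of_depth` — van Hove form per plaquette, arbitrary shapes;
* ★★ `suN_neg_klDiv_sub_energy_le_dim` — every `N ≥ 2`, every `d ≥ 2` on the 't Hooft window (`BoundaryFreeEnergyDim`).
WHAT THIS IS NOT: lattice strong coupling; the infinite-volume variational principle (specific entropy / pressure functionals on
translation-invariant states) is not formalised here — this is its finite-volume, boundary-uniform form; nothing about the continuum limit or Clay.
References: O. E. Lanford, D. Ruelle, Comm. Math. Phys. 13 (1969) 194–215; H.-O. Georgii, *Gibbs Measures and Phase Transitions* (2011), §15.3–15.4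
(statement shape); everything here is proved. [folklore]
-/

noncomputable section

open MeasureTheory ProbabilityTheory InformationTheory Real Finset Set
open scoped NNReal ENNReal
open Literature.Probability.LatticeModels hiding configShift configShift_apply
open Literature.MathematicalPhysics.QuantumLattice
open Literature.MathematicalPhysics.QuantumFieldTheory (haarProbability)
open Summit.Ventures.YMGap.StarWindowGauge (gaugeR gaugeR_lt_one_of_le)
open Summit.Ventures.YMGap.StarLemmaG (gaugeR_nonneg)

namespace Summit.Ventures.YMGap.RobustBall

namespace BoundaryFreeEnergy

/-! ### Part A — generic: the variational identity and inequality in a finite volume with a boundary field -/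

section Generic

variable {d N : ℕ} {G : Type*} [Group G] [TopologicalSpace G] [IsTopologicalGroup G] [CompactSpace G]
  [MeasurableSpace G] [BorelSpace G] [SecondCountableTopology G] (ρ : G →* Matrix (Fin N) (Fin N) ℂ)

/-- **The variational identity**: for every probability law `ν` on the inner links with `ν ≪ Haar_Λ` and integrable log-likelihood ratio,
`KL(ν ‖ π_Λ^{b,η}) = KL(ν ‖ Haar_Λ) + b·ν(S_Λ(· ⊕ η)) + log Z_Λ(b|η)` (Mathlib's `integral_llr_tilted_right`). [folklore] -/
theorem toReal_klDiv_inner_law_eq (hρ : Continuous ρ) (b : ℝ) (Λ : Finset (ZdEdge d)) (η : LGConfig d G)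
    (ν : Measure (↥Λ → G)) [IsProbabilityMeasure ν] (hν : ν ≪ Measure.pi fun _ : ↥Λ => haarProbability G)
    (hint : Integrable (llr ν (Measure.pi fun _ : ↥Λ => haarProbability G)) ν) :
    (klDiv ν ((Measure.pi fun _ : ↥Λ => haarProbability G).tilted
        (fun ζ => -b * wilsonBoundaryAction ρ Λ (glueWith Λ ζ η)))).toReal =
      (klDiv ν (Measure.pi fun _ : ↥Λ => haarProbability G)).toReal + b * ∫ ζ, wilsonBoundaryAction ρ Λ (glueWith Λ ζ η) ∂ν +
        Real.log (∫ ζ, Real.exp (-b * wilsonBoundaryAction ρ Λ (glueWith Λ ζ η)) ∂(Measure.pi fun _ : ↥Λ => haarProbability G)) := by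
  set H : Measure (↥Λ → G) := Measure.pi fun _ : ↥Λ => haarProbability G with hH
  set f : (↥Λ → G) → ℝ := fun ζ => -b * wilsonBoundaryAction ρ Λ (glueWith Λ ζ η) with hf
  haveI : IsProbabilityMeasure H := by rw [hH]; infer_instance
  have hS : Continuous (wilsonBoundaryAction (G := G) ρ Λ) := continuous_wilsonBoundaryAction ρ hρ Λ
  obtain ⟨C, hC⟩ := exists_bound_of_continuous hS
  have hfm : Measurable f := (hS.measurable.comp (measurable_glueWith Λ η)).const_mul _
  have hfb : ∀ ζ, |f ζ| ≤ |b| * C := fun ζ => by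
    rw [hf]; dsimp only; rw [abs_mul, abs_neg]; exact mul_le_mul_of_nonneg_left (hC _) (abs_nonneg b)
  have hfν : Integrable f ν := integrable_of_bound hfm.aestronglyMeasurable (C := |b| * C) fun ζ => hfb ζ
  have hexpH : Integrable (fun ζ => Real.exp (f ζ)) H := integrable_exp_neg_mul_action_glueWith ρ hρ b Λ η H
  have hνπ : ν ≪ H.tilted f := hν.trans (absolutelyContinuous_tilted hexpH)
  haveI : IsProbabilityMeasure (H.tilted f) := isProbabilityMeasure_tilted hexpH
  rw [toReal_klDiv_of_measure_eq hνπ (by simp), toReal_klDiv_of_measure_eq hν (by simp),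
    integral_llr_tilted_right hν hfν hexpH hint, hf]
  simp only [integral_const_mul]
  ring

/-- ★★ **THE GIBBS VARIATIONAL INEQUALITY IN A FINITE VOLUME WITH A BOUNDARY FIELD**: for every probability law `ν ≪ Haar_Λ` with integrable
log-likelihood ratio, `−KL(ν ‖ Haar_Λ) − b·ν(S_Λ(· ⊕ η)) ≤ log Z_Λ(b|η)`; the deficit is `KL(ν ‖ π_Λ^{b,η}) ≥ 0`. [folklore] -/
theorem neg_klDiv_sub_energy_le_log_normaliser (hρ : Continuous ρ) (b : ℝ) (Λ : Finset (ZdEdge d)) (η : LGConfig d G)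
    (ν : Measure (↥Λ → G)) [IsProbabilityMeasure ν] (hν : ν ≪ Measure.pi fun _ : ↥Λ => haarProbability G)
    (hint : Integrable (llr ν (Measure.pi fun _ : ↥Λ => haarProbability G)) ν) :
    -(klDiv ν (Measure.pi fun _ : ↥Λ => haarProbability G)).toReal - b * ∫ ζ, wilsonBoundaryAction ρ Λ (glueWith Λ ζ η) ∂ν ≤
      Real.log (∫ ζ, Real.exp (-b * wilsonBoundaryAction ρ Λ (glueWith Λ ζ η)) ∂(Measure.pi fun _ : ↥Λ => haarProbability G)) := by
  have h := toReal_klDiv_inner_law_eq ρ hρ b Λ η ν hν hint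
  have h0 : 0 ≤ (klDiv ν ((Measure.pi fun _ : ↥Λ => haarProbability G).tilted
      (fun ζ => -b * wilsonBoundaryAction ρ Λ (glueWith Λ ζ η)))).toReal := ENNReal.toReal_nonneg
  linarith

/-- **The same for EVERY inner probability law, in `ℝ≥0∞`** (no absolute-continuity or integrability hypothesis: when either fails the right
side is `∞`): `(−b·ν(S_Λ(· ⊕ η)) − log Z_Λ(b|η))⁺ ≤ KL(ν ‖ Haar_Λ)`. [folklore] -/
theorem ofReal_neg_energy_sub_log_normaliser_le_klDiv (hρ : Continuous ρ) (b : ℝ) (Λ : Finset (ZdEdge d)) (η : LGConfig d G)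
    (ν : Measure (↥Λ → G)) [IsProbabilityMeasure ν] :
    ENNReal.ofReal (-(b * ∫ ζ, wilsonBoundaryAction ρ Λ (glueWith Λ ζ η) ∂ν) -
        Real.log (∫ ζ, Real.exp (-b * wilsonBoundaryAction ρ Λ (glueWith Λ ζ η)) ∂(Measure.pi fun _ : ↥Λ => haarProbability G))) ≤
      klDiv ν (Measure.pi fun _ : ↥Λ => haarProbability G) := by
  by_cases h : ν ≪ (Measure.pi fun _ : ↥Λ => haarProbability G) ∧ Integrable (llr ν (Measure.pi fun _ : ↥Λ => haarProbability G)) ν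
  · have h1 := neg_klDiv_sub_energy_le_log_normaliser ρ hρ b Λ η ν h.1 h.2
    rw [← ENNReal.ofReal_toReal (klDiv_ne_top h.1 h.2)]
    exact ENNReal.ofReal_le_ofReal (by linarith)
  · rw [klDiv_eq_top_iff.2 fun h1 h2 => h ⟨h1, h2⟩]
    exact le_top

/-- **Equality for the inner Gibbs law** (the supremum is attained): `log Z_Λ(b|η) = −KL(π_Λ^{b,η} ‖ Haar_Λ) − b·γ_Λ^b(S_Λ|η)`, the energy
written on the DLR kernel `γ_Λ^b(·|η)` (tree `ymSpecification`) — the entropy identity of `BoundaryRelativeEntropy`, rearranged. [folklore] -/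
theorem log_normaliser_eq_neg_klDiv_sub_kernel_energy (hρ : Continuous ρ) (b : ℝ) (Λ : Finset (ZdEdge d)) (η : LGConfig d G) :
    Real.log (∫ ζ, Real.exp (-b * wilsonBoundaryAction ρ Λ (glueWith Λ ζ η)) ∂(Measure.pi fun _ : ↥Λ => haarProbability G)) =
      -(klDiv ((Measure.pi fun _ : ↥Λ => haarProbability G).tilted (fun ζ => -b * wilsonBoundaryAction ρ Λ (glueWith Λ ζ η)))
          (Measure.pi fun _ : ↥Λ => haarProbability G)).toReal -
        b * ∫ U, wilsonBoundaryAction ρ Λ U ∂(ymSpecification ρ b Λ η) := by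
  rw [toReal_klDiv_inner_law_haar_eq ρ hρ b Λ η]
  ring

/-- **The maximiser is unique**: a probability law `ν ≪ Haar_Λ` with integrable log-likelihood ratio attaining the bound,
`−KL(ν ‖ Haar_Λ) − b·ν(S_Λ(· ⊕ η)) = log Z_Λ(b|η)`, IS the inner Gibbs law `π_Λ^{b,η}` (the deficit `KL(ν ‖ π_Λ^{b,η})` vanishes). [folklore] -/
theorem eq_inner_law_of_deficit_eq_zero (hρ : Continuous ρ) (b : ℝ) (Λ : Finset (ZdEdge d)) (η : LGConfig d G)
    (ν : Measure (↥Λ → G)) [IsProbabilityMeasure ν] (hν : ν ≪ Measure.pi fun _ : ↥Λ => haarProbability G)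
    (hint : Integrable (llr ν (Measure.pi fun _ : ↥Λ => haarProbability G)) ν)
    (heq : -(klDiv ν (Measure.pi fun _ : ↥Λ => haarProbability G)).toReal - b * ∫ ζ, wilsonBoundaryAction ρ Λ (glueWith Λ ζ η) ∂ν =
      Real.log (∫ ζ, Real.exp (-b * wilsonBoundaryAction ρ Λ (glueWith Λ ζ η)) ∂(Measure.pi fun _ : ↥Λ => haarProbability G))) :
    ν = (Measure.pi fun _ : ↥Λ => haarProbability G).tilted (fun ζ => -b * wilsonBoundaryAction ρ Λ (glueWith Λ ζ η)) := by
  set H : Measure (↥Λ → G) := Measure.pi fun _ : ↥Λ => haarProbability G with hH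
  haveI : IsProbabilityMeasure H := by rw [hH]; infer_instance
  have hexpH : Integrable (fun ζ => Real.exp (-b * wilsonBoundaryAction ρ Λ (glueWith Λ ζ η))) H :=
    integrable_exp_neg_mul_action_glueWith ρ hρ b Λ η H
  haveI : IsProbabilityMeasure (H.tilted fun ζ => -b * wilsonBoundaryAction ρ Λ (glueWith Λ ζ η)) := isProbabilityMeasure_tilted hexpH
  have h := toReal_klDiv_inner_law_eq ρ hρ b Λ η ν hν hint
  have h0 : (klDiv ν (H.tilted fun ζ => -b * wilsonBoundaryAction ρ Λ (glueWith Λ ζ η))).toReal = 0 := by linarith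
  have hne : klDiv ν (H.tilted fun ζ => -b * wilsonBoundaryAction ρ Λ (glueWith Λ ζ η)) ≠ ∞ := by
    refine klDiv_ne_top (hν.trans (absolutelyContinuous_tilted hexpH)) ?_
    have hS : Continuous (wilsonBoundaryAction (G := G) ρ Λ) := continuous_wilsonBoundaryAction ρ hρ Λ
    obtain ⟨C, hC⟩ := exists_bound_of_continuous hS
    have hfm : Measurable fun ζ : ↥Λ → G => -b * wilsonBoundaryAction ρ Λ (glueWith Λ ζ η) :=
      (hS.measurable.comp (measurable_glueWith Λ η)).const_mul _
    refine integrable_llr_tilted_right hν (integrable_of_bound hfm.aestronglyMeasurable (C := |b| * C) fun ζ => ?_) hint hexpH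
    rw [abs_mul, abs_neg]; exact mul_le_mul_of_nonneg_left (hC _) (abs_nonneg b)
  have hz : klDiv ν (H.tilted fun ζ => -b * wilsonBoundaryAction ρ Λ (glueWith Λ ζ η)) = 0 := by
    rw [← ENNReal.ofReal_toReal hne, h0, ENNReal.ofReal_zero]
  exact klDiv_eq_zero_iff.1 hz

end Generic

/-! ### Part B — `SU(2)` on `ℤ⁴`, EVERY `0 ≤ β_W ≤ 9/25`: the boundary-uniform finite-volume variational principle -/

section Cells

/-- ★★★ **THE GIBBS VARIATIONAL PRINCIPLE IN A FINITE REGION WITH AN ARBITRARY BOUNDARY FIELD, `SU(2)` ON `ℤ⁴`, EVERY `0 ≤ β_W ≤ 9/25`**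
(tree coupling `0 ≤ b ≤ 9/50`; finite `Λ`, boundary field `η`, depth data `(φ, m)`): for EVERY probability law `ν` on the links of `Λ` with
`ν ≪ Haar_Λ` and integrable log-likelihood ratio,
`−KL(ν ‖ Haar_Λ) − b·ν(S_Λ(· ⊕ η)) ≤ (#T(Λ)/6)·f(b) + b·Σ_{p∈T(Λ)} min 4 (1024√2·e^{−κ₁(R_G(2b))⌊m_p/4⌋})` — no inner state beats the volume
times the infinite-volume free energy per plaquette by more than a SURFACE term, the same for all boundary fields. [folklore] -/
theorem su2_neg_klDiv_sub_energy_le {b : ℝ} (hb0 : 0 ≤ b) (hb : b ≤ 9 / 50) (Λ : Finset (ZdEdge 4)) (η : LGConfig 4 (SUN 2))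
    (φ : ZdEdge 4 → ℝ) (hφ : ∀ x y : ZdEdge 4, φ x ≤ φ y + ‖x.1 - y.1‖) (hφΛ : ∀ x, 0 < φ x → x ∈ Λ)
    (m : ZdPlaquette 4 → ℝ) (hm : ∀ p ∈ plaquettesTouching Λ, ∀ x ∈ plaquetteEdges p, m p ≤ φ x)
    (ν : Measure (↥Λ → SUN 2)) [IsProbabilityMeasure ν] (hν : ν ≪ Measure.pi fun _ : ↥Λ => haarProbability (SUN 2))
    (hint : Integrable (llr ν (Measure.pi fun _ : ↥Λ => haarProbability (SUN 2))) ν) :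
    -(klDiv ν (Measure.pi fun _ : ↥Λ => haarProbability (SUN 2))).toReal -
        b * ∫ ζ, wilsonBoundaryAction (fundamentalRep (Fin 2)) Λ (glueWith Λ ζ η) ∂ν ≤
      (plaquettesTouching Λ).card / 6 * freeEnergyDensity 4 (fundamentalRep (Fin 2)) b +
        b * ∑ p ∈ plaquettesTouching Λ, min 4 (1024 * Real.sqrt 2 * Real.exp (-(starRate 4 (gaugeR (2 * b)) * ⌊m p / (4 : ℕ)⌋₊))) := by
  have hρc : Continuous (fundamentalRep (Fin 2)) := continuous_fundamentalRep (Fin 2)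
  have h1 := neg_klDiv_sub_energy_le_log_normaliser (fundamentalRep (Fin 2)) hρc b Λ η ν hν hint
  have h2 := su2_abs_log_normaliser_sub_freeEnergy_le hb0 hb Λ η φ hφ hφΛ m hm
  rw [abs_le] at h2
  linarith [h2.2]

/-- ★★ **… AND THE INNER GIBBS LAW ATTAINS IT UP TO THE SAME SURFACE TERM**: `(#T(Λ)/6)·f(b) − b·Σ_{p∈T(Λ)} min 4 (…) ≤
−KL(π_Λ^{b,η} ‖ Haar_Λ) − b·γ_Λ^b(S_Λ|η)` — so the supremum over inner states of (minus relative entropy to Haar − b × energy) equals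
`(#T(Λ)/6)·f(b)` within `± b·(surface sum)`, for EVERY boundary field. [folklore] -/
theorem su2_variational_lower {b : ℝ} (hb0 : 0 ≤ b) (hb : b ≤ 9 / 50) (Λ : Finset (ZdEdge 4)) (η : LGConfig 4 (SUN 2))
    (φ : ZdEdge 4 → ℝ) (hφ : ∀ x y : ZdEdge 4, φ x ≤ φ y + ‖x.1 - y.1‖) (hφΛ : ∀ x, 0 < φ x → x ∈ Λ)
    (m : ZdPlaquette 4 → ℝ) (hm : ∀ p ∈ plaquettesTouching Λ, ∀ x ∈ plaquetteEdges p, m p ≤ φ x) :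
    (plaquettesTouching Λ).card / 6 * freeEnergyDensity 4 (fundamentalRep (Fin 2)) b -
        b * ∑ p ∈ plaquettesTouching Λ, min 4 (1024 * Real.sqrt 2 * Real.exp (-(starRate 4 (gaugeR (2 * b)) * ⌊m p / (4 : ℕ)⌋₊))) ≤
      -(klDiv ((Measure.pi fun _ : ↥Λ => haarProbability (SUN 2)).tilted
            (fun ζ => -b * wilsonBoundaryAction (fundamentalRep (Fin 2)) Λ (glueWith Λ ζ η)))
          (Measure.pi fun _ : ↥Λ => haarProbability (SUN 2))).toReal -
        b * ∫ U, wilsonBoundaryAction (fundamentalRep (Fin 2)) Λ U ∂(ymSpecification (d := 4) (fundamentalRep (Fin 2)) b Λ η) := by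
  have hρc : Continuous (fundamentalRep (Fin 2)) := continuous_fundamentalRep (Fin 2)
  rw [← log_normaliser_eq_neg_klDiv_sub_kernel_energy (fundamentalRep (Fin 2)) hρc b Λ η]
  have h2 := su2_abs_log_normaliser_sub_freeEnergy_le hb0 hb Λ η φ hφ hφΛ m hm
  rw [abs_le] at h2
  linarith [h2.1]

/-- ★★ **VAN HOVE FORM, ARBITRARY SHAPES** (`T(Λ) ≠ ∅`, depth budget `K`): for every inner probability law `ν ≪ Haar_Λ` with integrable
log-likelihood ratio, `(−KL(ν ‖ Haar_Λ) − b·ν(S_Λ(· ⊕ η)))/#T(Λ) ≤ f(b)/6 + b·(1024√2·e^{−κ₁(R_G(2b))K} + 4·#{p ∈ T(Λ) : m_p < 4K}/#T(Λ))` — per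
plaquette, no inner state beats the infinite-volume free energy by more than `O(e^{−κK} + #shallow/#volume)`, uniformly in the boundary field.
[folklore] -/
theorem su2_variational_div_le_of_depth {b : ℝ} (hb0 : 0 ≤ b) (hb : b ≤ 9 / 50) (Λ : Finset (ZdEdge 4))
    (hT : (plaquettesTouching Λ).Nonempty) (η : LGConfig 4 (SUN 2))
    (φ : ZdEdge 4 → ℝ) (hφ : ∀ x y : ZdEdge 4, φ x ≤ φ y + ‖x.1 - y.1‖) (hφΛ : ∀ x, 0 < φ x → x ∈ Λ)
    (m : ZdPlaquette 4 → ℝ) (hm : ∀ p ∈ plaquettesTouching Λ, ∀ x ∈ plaquetteEdges p, m p ≤ φ x) (K : ℕ)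
    (ν : Measure (↥Λ → SUN 2)) [IsProbabilityMeasure ν] (hν : ν ≪ Measure.pi fun _ : ↥Λ => haarProbability (SUN 2))
    (hint : Integrable (llr ν (Measure.pi fun _ : ↥Λ => haarProbability (SUN 2))) ν) :
    (-(klDiv ν (Measure.pi fun _ : ↥Λ => haarProbability (SUN 2))).toReal -
        b * ∫ ζ, wilsonBoundaryAction (fundamentalRep (Fin 2)) Λ (glueWith Λ ζ η) ∂ν) / (plaquettesTouching Λ).card ≤
      freeEnergyDensity 4 (fundamentalRep (Fin 2)) b / 6 +
        b * (1024 * Real.sqrt 2 * Real.exp (-(starRate 4 (gaugeR (2 * b)) * K)) +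
          4 * ((plaquettesTouching Λ).filter fun p => m p < 4 * K).card / (plaquettesTouching Λ).card) := by
  have hρc : Continuous (fundamentalRep (Fin 2)) := continuous_fundamentalRep (Fin 2)
  have hTpos : (0 : ℝ) < ((plaquettesTouching Λ).card : ℝ) := by exact_mod_cast Finset.card_pos.2 hT
  have h1 := neg_klDiv_sub_energy_le_log_normaliser (fundamentalRep (Fin 2)) hρc b Λ η ν hν hint
  have h2 := su2_abs_log_normaliser_div_sub_le_of_depth hb0 hb Λ hT η φ hφ hφΛ m hm K
  rw [abs_le] at h2
  have h3 := div_le_div_of_nonneg_right h1 hTpos.le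
  linarith [h2.2]

/-- ★★ **EVERY `N ≥ 2`, EVERY `d ≥ 2`, THE 'T HOOFT WINDOW** (`0 ≤ β ≤ 1/(12(d−1))`, `β < 1/(8d)`, tree coupling `Nβ`, ratio `max(ρ,½)` with
`6(d−1)β/(½ − 2(d−1)β) ≤ ρ < 1`; depths `D_p ≤ ‖y − z‖_∞` for every link `y` of `p`, `z ∉ Λ`): for every inner probability law `ν ≪ Haar_Λ` with
integrable log-likelihood ratio,
`−KL(ν ‖ Haar_Λ) − Nβ·ν(S_Λ(· ⊕ η)) ≤ (#T(Λ)/#planes(d))·f(Nβ) + Nβ·Σ_{p∈T(Λ)} min (2N) (32N⁴√N·max(ρ,½)^{⌊D_p⌋})` — HYPOTHESIS-FREE. [folklore] -/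
theorem suN_neg_klDiv_sub_energy_le_dim {d N : ℕ} (hd : 2 ≤ d) (hN : 2 ≤ N) {β ρ : ℝ} (hβ0 : 0 ≤ β)
    (hβ : β ≤ 1 / (12 * ((d : ℝ) - 1))) (hβ' : β < 1 / (8 * (d : ℝ)))
    (hρ : 6 * ((d : ℝ) - 1) * β / (1 / 2 - β * (2 * ((d : ℝ) - 1))) ≤ ρ) (hρ1 : ρ < 1) [DecidableEq (ZdEdge d)]
    (Λ : Finset (ZdEdge d)) (η : LGConfig d (SUN N)) (D : ZdPlaquette d → ℝ)
    (hD : ∀ p ∈ plaquettesTouching Λ, ∀ y ∈ plaquetteEdges p, ∀ z, z ∉ Λ → D p ≤ ‖y.1 - z.1‖)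
    (ν : Measure (↥Λ → SUN N)) [IsProbabilityMeasure ν] (hν : ν ≪ Measure.pi fun _ : ↥Λ => haarProbability (SUN N))
    (hint : Integrable (llr ν (Measure.pi fun _ : ↥Λ => haarProbability (SUN N))) ν) :
    -(klDiv ν (Measure.pi fun _ : ↥Λ => haarProbability (SUN N))).toReal -
        N * β * ∫ ζ, wilsonBoundaryAction (fundamentalRep (Fin N)) Λ (glueWith Λ ζ η) ∂ν ≤
      (plaquettesTouching Λ).card / (Fintype.card {q : Fin d × Fin d // q.1 < q.2} : ℝ) * freeEnergyDensity d (fundamentalRep (Fin N)) (N * β) +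
        N * β * ∑ p ∈ plaquettesTouching Λ, min (2 * (N : ℝ)) (32 * (N : ℝ) ^ 4 * Real.sqrt N * (max ρ (1 / 2)) ^ ⌊D p⌋₊) := by
  haveI : SecondCountableTopology (Matrix.specialUnitaryGroup (Fin N) ℂ) :=
    haveI : SecondCountableTopology (Matrix (Fin N) (Fin N) ℂ) := inferInstanceAs (SecondCountableTopology (Fin N → Fin N → ℂ))
    Topology.IsEmbedding.subtypeVal.secondCountableTopology
  have hρc : Continuous (fundamentalRep (Fin N)) := continuous_fundamentalRep (Fin N)
  have h1 := neg_klDiv_sub_energy_le_log_normaliser (fundamentalRep (Fin N)) hρc (N * β) Λ η ν hν hint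
  have h2 := suN_abs_log_normaliser_sub_freeEnergy_le hd hN hβ0 hβ hβ' hρ hρ1 Λ η D hD
  rw [abs_le] at h2
  linarith [h2.2]

end Cells


end BoundaryFreeEnergy

end Summit.Ventures.YMGap.RobustBall

end
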